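import Summits.ResolutionOfSingularities.ResolutionOfSingularities.Theorems.FrobeniusLadderFRationalResolutionConeCertificateResolution
import Summits.ResolutionOfSingularities.ResolutionOfSingularities.Theorems.FrobeniusLadderFRationalResolutionTwoStepCertificateTrivial
import HarnessLib

/-!
# Crux `FrobeniusLadder.FRationalResolution` (stmt-ResolutionOfSingularities-15317), line `redirect`,
# stub `stub_diagonalizableQuotientResolution` — REGULAR VERTEX CHARTS NEED NO CERTIFICATE: the per-chart certificate from cone data
# with a REGULAR cone monoid algebra, and the all-in-one recipe with MIXED (regular | cone) vertex charts

In a class certificate (`…ConeCertificateResolution`, p843926) every vertex chart `κ[P][𝔳/χ^{v}] ≅ κ[Q]` carries generators `G_Q`,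
face regularity and a vertex certificate of the monomial algebra of `G_Q`. Most vertex charts of a Newton polyhedron are SMOOTH
(`Q` free): for them all of this is superfluous — the chart ring is regular and `…TwoStepCertificateTrivial.certificate_of_isRegularRing`
(p843522) is the certificate. This file:

* ★★ `chartCertificate_of_regular_cone` — cone data `(Q, ι)` of the chart at `χ^{e₀}` (as in `…MonoidAlgebraChart.exists_algHom_chart`)
  with `κ[Q]` a regular ring ⇒ the per-chart certificate (any `𝔞`), by transport along `κ[Q] ≅ κ[P][J/χ^{e₀}]`;
* ★★★ `modelCertificate_of_mixedCone` — the model-side package of `…ConeCertificateModel.modelCertificate_of_cone` with, per vertex,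
  EITHER `IsRegularRing κ[Q]` OR the generators/faces/vertex data;
* ★★★★ `hasResolution_of_isolated_fixedPoints_of_mixedConeCertificate` — the all-in-one recipe (fixed-point data + mixed cone certificate,
  field-uniform: per vertex `∀ κ, IsRegularRing κ[Q]` — e.g. `Q = ⊤ ⊆ ℕ^{n'}` by `…MonoidAlgebraFreeRegular.isRegularRing_monoidAlgebra_top` —
  or the field-uniform face/vertex slots), through `…FieldUniformCertificate` (p843909).

Honest label: assembly toward ONE leaf stub (no stub, crux or summit closed). No definitions, no named facts, no sorry.
[folklore; cite: CoxLittleSchenck2011, §1.1, §3.3] [cite: Kato1994, Thm. (3.2)] [cite: Matsumura1987, Thm. 19.3]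
-/

noncomputable section

-- single-problem summit: the doubled namespace component is forced
set_option linter.dupNamespace false

open CategoryTheory AlgebraicGeometry TopologicalSpace IsLocalRing
open Literature.AlgebraicGeometry.Resolution

namespace Summit.ResolutionOfSingularities.ResolutionOfSingularities.Theorems.FRationalResolution.MonoidAlgebraLaurent

variable (κ : Type) [Field κ] {n : ℕ} (P : AddSubmonoid (Fin n →₀ ℕ))

/-- The exponent of `p ∈ ℕⁿ` in `ℤⁿ`. -/
local notation3 (prettyPrint := false) "toZ[" n "]" =>
  (Finsupp.mapRange.addMonoidHom (Nat.castAddMonoidHom ℤ) : (Fin n →₀ ℕ) →+ (Fin n →₀ ℤ))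

/-- The vertex ideal of the monoid algebra `κ[P]`. -/
local notation3 (prettyPrint := false) "𝕍[" κ ", " P "]" =>
  Ideal.span ((fun p : ↥P => AddMonoidAlgebra.single p (1 : κ)) '' {p : ↥P | p ≠ 0})

/-! ## §1 A regular chart -/

/-- ★★ **THE PER-CHART CERTIFICATE OF A REGULAR VERTEX CHART.** `P ⊆ ℕⁿ`, `E ⊆ P`, `e₀ ∈ P`, `J = (χᵉ : e ∈ E)`, `C = κ[P][J/χ^{e₀}]`,
cone data `(Q, ι)` as in `exists_algHom_chart` with `κ[Q]` a REGULAR ring: then `C ≅ κ[Q]` is regular and carries the per-chart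
certificate for any `𝔞` (`G' = {1}`, any maximal `𝔪`, `M = 1`). [folklore; cite: CoxLittleSchenck2011, §1.1] [cite: Matsumura1987, Thm. 19.3] -/
theorem chartCertificate_of_regular_cone (e₀ : ↥P) (E : Set ↥P)
    {n' : ℕ} (Q : AddSubmonoid (Fin n' →₀ ℕ)) (ι : ↥Q →+ (Fin n →₀ ℤ)) (hι : Function.Injective ι)
    (hE : ∀ e ∈ E, ∃ q : ↥Q, ι q = toZ[n] (e : Fin n →₀ ℕ) - toZ[n] (e₀ : Fin n →₀ ℕ))
    (hP : ∀ p : ↥P, ∃ q : ↥Q, ι q = toZ[n] (p : Fin n →₀ ℕ))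
    (hQ : ∀ q : ↥Q, ∃ (p : ↥P) (m : ℕ) (e : Fin m → ↥P), (∀ i, e i ∈ E) ∧
      ι q = toZ[n] (p : Fin n →₀ ℕ) + ∑ i, (toZ[n] ((e i : ↥P) : Fin n →₀ ℕ) - toZ[n] (e₀ : Fin n →₀ ℕ)))
    (hreg : IsRegularRing (AddMonoidAlgebra κ ↥Q))
    (𝔞 : Ideal (blowupAlgebra (Ideal.span ((fun e : ↥P => AddMonoidAlgebra.single e (1 : κ)) '' E))
      (AddMonoidAlgebra.single e₀ (1 : κ)))) :
    ∃ (G' : Set (blowupAlgebra (Ideal.span ((fun e : ↥P => AddMonoidAlgebra.single e (1 : κ)) '' E))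
          (AddMonoidAlgebra.single e₀ (1 : κ))))
      (𝔪 : Ideal (blowupAlgebra (Ideal.span ((fun e : ↥P => AddMonoidAlgebra.single e (1 : κ)) '' E))
          (AddMonoidAlgebra.single e₀ (1 : κ)))) (_ : 𝔪.IsMaximal) (M : ℕ),
      (∀ g ∈ G', IsRegularRing (Localization.Away g)) ∧ 𝔪 ^ M ≤ 𝔞 ⊔ Ideal.span G' ∧
      (¬ IsRegularLocalRing (Localization.AtPrime 𝔪) →
        Scheme.IsRegular (affineBlowup (R := Localization.AtPrime 𝔪) (maximalIdeal (Localization.AtPrime 𝔪)))) := by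
  classical
  -- the chart ring as the monoid algebra of `Q` (as in `chartCertificate_of_cone`)
  obtain ⟨Φ, hΦinj, hΦrange, -⟩ := exists_algHom_chart κ P e₀ E Q ι hι hE hP hQ
  have hΦmem : ∀ x, Φ x ∈ blowupAlgebra (Ideal.span ((fun e : ↥P => AddMonoidAlgebra.single e (1 : κ)) '' E))
      (AddMonoidAlgebra.single e₀ (1 : κ)) := fun x => by
    have : Φ x ∈ Set.range Φ := ⟨x, rfl⟩
    rw [hΦrange] at this
    exact this
  let f : AddMonoidAlgebra κ ↥Q →+* ↥(blowupAlgebra (Ideal.span ((fun e : ↥P => AddMonoidAlgebra.single e (1 : κ)) '' E))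
      (AddMonoidAlgebra.single e₀ (1 : κ))) :=
    Φ.toRingHom.codRestrict (blowupAlgebra (Ideal.span ((fun e : ↥P => AddMonoidAlgebra.single e (1 : κ)) '' E))
      (AddMonoidAlgebra.single e₀ (1 : κ))) hΦmem
  have hf : ∀ x, ((f x : ↥(blowupAlgebra (Ideal.span ((fun e : ↥P => AddMonoidAlgebra.single e (1 : κ)) '' E))
      (AddMonoidAlgebra.single e₀ (1 : κ)))) : Localization.Away (AddMonoidAlgebra.single e₀ (1 : κ))) = Φ x := fun _ => rfl
  have hfbij : Function.Bijective f := by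
    constructor
    · intro a b hab
      exact hΦinj (by rw [← hf, ← hf, hab])
    · intro z
      have hz : (z : Localization.Away (AddMonoidAlgebra.single e₀ (1 : κ))) ∈ Set.range Φ := by rw [hΦrange]; exact z.2
      obtain ⟨x, hx⟩ := hz
      exact ⟨x, Subtype.ext (by rw [hf, hx])⟩
  let e : AddMonoidAlgebra κ ↥Q ≃+* ↥(blowupAlgebra (Ideal.span ((fun e : ↥P => AddMonoidAlgebra.single e (1 : κ)) '' E))
      (AddMonoidAlgebra.single e₀ (1 : κ))) := RingEquiv.ofBijective f hfbij
  -- transport regularity and non-triviality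
  haveI : IsRegularRing ↥(blowupAlgebra (Ideal.span ((fun e : ↥P => AddMonoidAlgebra.single e (1 : κ)) '' E))
      (AddMonoidAlgebra.single e₀ (1 : κ))) := IsRegularRing.of_ringEquiv e
  haveI : Nontrivial ↥(blowupAlgebra (Ideal.span ((fun e : ↥P => AddMonoidAlgebra.single e (1 : κ)) '' E))
      (AddMonoidAlgebra.single e₀ (1 : κ))) := e.symm.toEquiv.nontrivial
  exact TwoStepChartFactsInterface.certificate_of_isRegularRing 𝔞

/-! ## §2 The model-side package with mixed vertex charts -/

/-- ★★★ **THE MODEL-SIDE CERTIFICATE FROM MIXED CONE DATA.** As `…ConeCertificateModel.modelCertificate_of_cone`, except that each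
vertex chart is certified EITHER by the regularity of its cone monoid algebra `κ[Q]` OR by generators `G_Q` with regular faces and a
vertex certificate. [folklore; cite: CoxLittleSchenck2011, §1.1, §3.3] -/
theorem modelCertificate_of_mixedCone
    (G : Set (Fin n →₀ ℕ)) (hG0 : (0 : Fin n →₀ ℕ) ∉ G) (hGP : AddSubmonoid.closure G = P)
    {N : ℕ} (gen : Fin N → ↥P) (hgenG : ∀ i, ((gen i : ↥P) : Fin n →₀ ℕ) ∈ G) (hGgen : ∀ g ∈ G, ∃ i, ((gen i : ↥P) : Fin n →₀ ℕ) = g)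
    {m : ℕ} (v : Fin m → ↥P) (hv0 : ∀ j, v j ≠ 0)
    (kk : ℕ) (hkk : 1 ≤ kk) (c : Fin N → Fin m) (jj : Fin N → ℕ) (hjj : ∀ i, jj i + 1 ≤ kk)
    (q : ∀ i, Fin (jj i) → ↥P) (hq0 : ∀ i l, q i l ≠ 0) (hid : ∀ i, (jj i + 1) • gen i = v (c i) + ∑ l, q i l)
    (hcone : ∀ j : Fin m, ∃ (n' : ℕ) (Q : AddSubmonoid (Fin n' →₀ ℕ)) (ι : ↥Q →+ (Fin n →₀ ℤ)) (_ : Function.Injective ι)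
      (_ : ∀ e : ↥P, e ≠ 0 → ∃ u : ↥Q, ι u = toZ[n] (e : Fin n →₀ ℕ) - toZ[n] ((v j : ↥P) : Fin n →₀ ℕ))
      (_ : ∀ p : ↥P, ∃ u : ↥Q, ι u = toZ[n] (p : Fin n →₀ ℕ))
      (_ : ∀ u : ↥Q, ∃ (p : ↥P) (r : ℕ) (e : Fin r → ↥P), (∀ i, e i ≠ 0) ∧
        ι u = toZ[n] (p : Fin n →₀ ℕ) + ∑ i, (toZ[n] ((e i : ↥P) : Fin n →₀ ℕ) - toZ[n] ((v j : ↥P) : Fin n →₀ ℕ))),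
      IsRegularRing (AddMonoidAlgebra κ ↥Q) ∨
      ∃ (GQ : Set (Fin n' →₀ ℕ)) (_ : GQ.Finite) (_ : (0 : Fin n' →₀ ℕ) ∉ GQ) (_ : AddSubmonoid.closure GQ = Q),
        (∀ u : ↥Q, (u : Fin n' →₀ ℕ) ∈ GQ → IsRegularRing (Localization.Away (AddMonoidAlgebra.single u (1 : κ)))) ∧
        (∀ (K : Type) [Field K], Scheme.IsRegular (affineBlowup (Ideal.span {w : ↥(Algebra.adjoin K
          ((fun d : Fin n' →₀ ℕ => MvPolynomial.monomial d (1 : K)) '' GQ)) |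
          ∃ d ∈ GQ, (w : MvPolynomial (Fin n') K) = MvPolynomial.monomial d 1})))) :
    ∃ (b nx : ℕ) (xv : Fin nx → AddMonoidAlgebra κ ↥P) (_ : 𝕍[κ, P] ^ (b + 1) = Ideal.span (Set.range xv))
      (m' : ℕ) (y : Fin m' → AddMonoidAlgebra κ ↥P) (_ : ∀ j, y j ∈ 𝕍[κ, P] ^ (b + 1)) (N' : ℕ)
      (_ : (𝕍[κ, P] ^ (b + 1)) ^ (N' + 1) ≤ Ideal.span (Set.range y) * (𝕍[κ, P] ^ (b + 1)) ^ N'),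
      ∀ j : Fin m', ∃ (G' : Set (blowupAlgebra (𝕍[κ, P] ^ (b + 1)) (y j))) (𝔪 : Ideal (blowupAlgebra (𝕍[κ, P] ^ (b + 1)) (y j)))
        (_ : 𝔪.IsMaximal) (M : ℕ),
        (∀ g ∈ G', IsRegularRing (Localization.Away g)) ∧
        𝔪 ^ M ≤ (𝕍[κ, P]).map (algebraMap _ (blowupAlgebra (𝕍[κ, P] ^ (b + 1)) (y j))) ⊔ Ideal.span G' ∧
        (¬ IsRegularLocalRing (Localization.AtPrime 𝔪) →
          Scheme.IsRegular (affineBlowup (R := Localization.AtPrime 𝔪) (maximalIdeal (Localization.AtPrime 𝔪)))) := by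
  have hgen0 : ∀ i, gen i ≠ 0 := fun i h => hG0 (by simpa [h] using hgenG i)
  have hV1 : 𝕍[κ, P] ^ (0 + 1) = 𝕍[κ, P] := by rw [zero_add, pow_one]
  have hxv : 𝕍[κ, P] ^ (0 + 1) = Ideal.span (Set.range fun i => AddMonoidAlgebra.single (gen i) (1 : κ)) := by
    rw [hV1, MonoidAlgebraModel.vertexIdeal_eq_span_image κ P G hG0 hGP]
    congr 1
    ext z
    constructor
    · rintro ⟨p, hp, rfl⟩
      obtain ⟨i, hi⟩ := hGgen _ hp
      exact ⟨i, by change AddMonoidAlgebra.single (gen i) (1 : κ) = AddMonoidAlgebra.single p 1; rw [Subtype.ext hi]⟩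
    · rintro ⟨i, rfl⟩
      exact ⟨gen i, hgenG i, rfl⟩
  have hyJ : ∀ j, AddMonoidAlgebra.single (v j) (1 : κ) ∈ 𝕍[κ, P] ^ (0 + 1) := fun j => by
    rw [hV1]
    exact MonoidAlgebraModel.single_mem_vertexIdeal κ P (v j) (hv0 j)
  have hred : (𝕍[κ, P] ^ (0 + 1)) ^ (N * (kk - 1) + 1) ≤
      Ideal.span (Set.range fun j => AddMonoidAlgebra.single (v j) (1 : κ)) * (𝕍[κ, P] ^ (0 + 1)) ^ (N * (kk - 1)) := by
    rw [hV1]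
    exact MonoidAlgebraModel.vertexIdeal_pow_le_of_nsmul_eq κ P (fun i => AddMonoidAlgebra.single (gen i) 1) gen hgen0
      (fun _ => rfl) (by rw [← hxv, hV1]) (Ideal.span (Set.range fun j => AddMonoidAlgebra.single (v j) (1 : κ)))
      (fun i => v (c i)) (fun i => Ideal.subset_span ⟨c i, rfl⟩) kk hkk jj hjj q hq0 hid
  refine ⟨0, N, fun i => AddMonoidAlgebra.single (gen i) 1, hxv, m, fun j => AddMonoidAlgebra.single (v j) 1, hyJ, N * (kk - 1),
    hred, fun j => ?_⟩
  have hj := hcone j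
  obtain ⟨n', Q, ι, hι, hE, hPQ, hQ, halt⟩ := hj
  -- the certificate for the chart at `vⱼ`, transported along `𝔳^(0+1) = 𝔳`
  have key : ∀ I : Ideal (AddMonoidAlgebra κ ↥P), I = 𝕍[κ, P] →
      ∃ (G' : Set (blowupAlgebra I (AddMonoidAlgebra.single (v j) (1 : κ))))
        (𝔪 : Ideal (blowupAlgebra I (AddMonoidAlgebra.single (v j) (1 : κ)))) (_ : 𝔪.IsMaximal) (M : ℕ),
        (∀ g ∈ G', IsRegularRing (Localization.Away g)) ∧
        𝔪 ^ M ≤ (𝕍[κ, P]).map (algebraMap _ (blowupAlgebra I (AddMonoidAlgebra.single (v j) (1 : κ)))) ⊔ Ideal.span G' ∧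
        (¬ IsRegularLocalRing (Localization.AtPrime 𝔪) →
          Scheme.IsRegular (affineBlowup (R := Localization.AtPrime 𝔪) (maximalIdeal (Localization.AtPrime 𝔪)))) := by
    intro I hI
    subst hI
    rcases halt with hreg | ⟨GQ, hGQfin, hGQ0, hGQ, hface, hvert⟩
    · exact chartCertificate_of_regular_cone κ P (v j) {p : ↥P | p ≠ 0} Q ι hι (fun e he => hE e he) hPQ
        (fun u => by obtain ⟨p, r, e, he, hu⟩ := hQ u; exact ⟨p, r, e, he, hu⟩) hreg _
    · exact chartCertificate_of_cone κ P (v j) {p : ↥P | p ≠ 0} Q ι hι (fun e he => hE e he) hPQ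
        (fun u => by obtain ⟨p, r, e, he, hu⟩ := hQ u; exact ⟨p, r, e, he, hu⟩) GQ hGQfin hGQ0 hGQ hface hvert _
  exact key _ hV1

/-! ## §3 The all-in-one recipe with mixed vertex charts -/

/-- ★★★★ **RESOLUTION FROM FIXED-POINT DATA AND A MIXED CONE CERTIFICATE.** As
`hasResolution_of_isolated_fixedPoints_of_coneCertificate` (p843926), each vertex chart being certified either by
`∀ κ, IsRegularRing κ[Q]` (smooth chart; e.g. `Q = ⊤` by `isRegularRing_monoidAlgebra_top`) or by generators, field-uniform face
regularity and a field-uniform vertex certificate. [cite: Kato1994, Thm. (3.2)] [cite: Kollar2007, §2.2]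
[folklore; cite: CoxLittleSchenck2011, §1.1, §3.3] -/
theorem hasResolution_of_isolated_fixedPoints_of_mixedConeCertificate (k : Type) [Field k] (X : Scheme.{0}) [IsIntegral X]
    (f : X ⟶ Spec (.of k)) [LocallyOfFiniteType f] (hfin : (Scheme.regularLocus X)ᶜ.Finite)
    (hchart : ∀ t : X, t ∉ Scheme.regularLocus X →
      ∃ (k' : Type) (_ : Field k') (A : Type) (_ : DecidableEq A) (_ : AddCommGroup A) (_ : AddMonoid.IsTorsion A)
        (S : Type) (_ : CommRing S) (_ : Algebra k' S) (𝒮 : A → Submodule k' S) (_ : GradedAlgebra 𝒮)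
        (_ : Algebra.FiniteType k' S) (φ : Spec (.of (𝒮 0)) ⟶ X) (_ : Etale φ)
        (𝔔 : Ideal S) (_ : 𝔔.IsPrime) (_ : ∀ a : A, a ≠ 0 → ∀ s ∈ 𝒮 a, s ∈ 𝔔)
        (n : ℕ) (x : Fin n → S) (a : Fin n → A) (P : AddSubmonoid (Fin n →₀ ℕ))
        (_ : ∀ i, x i ∈ 𝔔 ∧ x i ∈ 𝒮 (a i))
        (_ : Ideal.span (algebraMap S (Localization.AtPrime 𝔔) '' Set.range x) = maximalIdeal (Localization.AtPrime 𝔔))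
        (_ : (n : WithBot ℕ∞) = ringKrullDim (Localization.AtPrime 𝔔))
        (_ : ∀ m, m ∈ P ↔ Finsupp.weight a m = 0)
        (G : Set (Fin n →₀ ℕ)) (_ : G.Finite) (_ : (0 : Fin n →₀ ℕ) ∉ G) (_ : AddSubmonoid.closure G = P),
        φ ⟨𝔔.comap (algebraMap (𝒮 0) S), inferInstance⟩ = t ∧
        ∃ (N : ℕ) (gen : Fin N → ↥P) (_ : ∀ i, ((gen i : ↥P) : Fin n →₀ ℕ) ∈ G)
          (_ : ∀ g ∈ G, ∃ i, ((gen i : ↥P) : Fin n →₀ ℕ) = g)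
          (m : ℕ) (v : Fin m → ↥P) (_ : ∀ j, v j ≠ 0)
          (kk : ℕ) (_ : 1 ≤ kk) (c : Fin N → Fin m) (jj : Fin N → ℕ) (_ : ∀ i, jj i + 1 ≤ kk)
          (q : ∀ i, Fin (jj i) → ↥P) (_ : ∀ i l, q i l ≠ 0) (_ : ∀ i, (jj i + 1) • gen i = v (c i) + ∑ l, q i l),
          ∀ j : Fin m, ∃ (n' : ℕ) (Q : AddSubmonoid (Fin n' →₀ ℕ)) (ι : ↥Q →+ (Fin n →₀ ℤ)) (_ : Function.Injective ι)
            (_ : ∀ e : ↥P, e ≠ 0 → ∃ u : ↥Q, ι u = toZ[n] (e : Fin n →₀ ℕ) - toZ[n] ((v j : ↥P) : Fin n →₀ ℕ))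
            (_ : ∀ p : ↥P, ∃ u : ↥Q, ι u = toZ[n] (p : Fin n →₀ ℕ))
            (_ : ∀ u : ↥Q, ∃ (p : ↥P) (r : ℕ) (e : Fin r → ↥P), (∀ i, e i ≠ 0) ∧
              ι u = toZ[n] (p : Fin n →₀ ℕ) + ∑ i, (toZ[n] ((e i : ↥P) : Fin n →₀ ℕ) - toZ[n] ((v j : ↥P) : Fin n →₀ ℕ))),
            (∀ (κ : Type) [Field κ], IsRegularRing (AddMonoidAlgebra κ ↥Q)) ∨
            ∃ (GQ : Set (Fin n' →₀ ℕ)) (_ : GQ.Finite) (_ : (0 : Fin n' →₀ ℕ) ∉ GQ) (_ : AddSubmonoid.closure GQ = Q),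
              (∀ (κ : Type) [Field κ], ∀ u : ↥Q, (u : Fin n' →₀ ℕ) ∈ GQ →
                IsRegularRing (Localization.Away (AddMonoidAlgebra.single u (1 : κ)))) ∧
              (∀ (K : Type) [Field K], Scheme.IsRegular (affineBlowup (Ideal.span {w : ↥(Algebra.adjoin K
                ((fun d : Fin n' →₀ ℕ => MvPolynomial.monomial d (1 : K)) '' GQ)) |
                ∃ d ∈ GQ, (w : MvPolynomial (Fin n') K) = MvPolynomial.monomial d 1})))) :
    Scheme.HasResolution X := by
  refine MonoidAlgebraModel.hasResolution_of_isolated_fixedPoints_of_fieldUniform_certificate k X f hfin fun t ht => ?_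
  have hc := hchart t ht
  obtain ⟨k', ik, A, iA₁, iA₂, hA, S, iS₁, iS₂, 𝒮, i𝒮, iS₃, φ, iφ, 𝔔, i𝔔, hfix, n, x, a, P, hxa, hspan, hn, hP, G, hGfin, hG0,
    hGP, hφt, N, gen, hgenG, hGgen, m, v, hv0, kk, hkk, c, jj, hjj, q, hq0, hid, hcone⟩ := hc
  refine ⟨k', ik, A, iA₁, iA₂, hA, S, iS₁, iS₂, 𝒮, i𝒮, iS₃, φ, iφ, 𝔔, i𝔔, hfix, n, x, a, P, hxa, hspan, hn, hP, G, hGfin, hG0, hGP,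
    hφt, fun κ _ => ?_⟩
  refine modelCertificate_of_mixedCone κ P G hG0 hGP gen hgenG hGgen v hv0 kk hkk c jj hjj q hq0 hid fun j => ?_
  have hj := hcone j
  obtain ⟨n', Q, ι, hι, hE, hPQ, hQ, halt⟩ := hj
  refine ⟨n', Q, ι, hι, hE, hPQ, hQ, ?_⟩
  rcases halt with hreg | ⟨GQ, hGQfin, hGQ0, hGQ, hface, hvert⟩
  · exact Or.inl (hreg κ)
  · exact Or.inr ⟨GQ, hGQfin, hGQ0, hGQ, hface κ, fun K _ => hvert K⟩

end Summit.ResolutionOfSingularities.ResolutionOfSingularities.Theorems.FRationalResolution.MonoidAlgebraLaurent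

end
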